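import Mathlib
import Literature.Analysis.Convexity.AnisotropicPerimeterPatches
import Literature.Analysis.Convexity.AnisotropicPerimeterLocalized
import HarnessLib

/-!
# The patch theorem LOCALIZED: `Σ_{patches inside U} h_K(a_m)·area_m ≤ P_K(S; U)`

Topic `Literature/Analysis/Convexity`; namespace `Literature.Analysis.Convexity`.
The lower-bound half of the abstract facet formula `anisotropicPerimeter_eq_facetSum_of_patches`
(`AnisotropicPerimeterPatches.lean`: Maggi 2012 (20.2) p. 258 / Remark 20.3; Evans–Gariepy Thm 5.16, polyhedral
case), for the perimeter RELATIVE TO AN OPEN SET `U` (Maggi (12.2)–(12.3) p. 122, here the distributional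
`anisotropicPerimeterIn K S U`: test fields with topological support inside `U`).  Setting: a set `S ⊆ V` whose
divergence integrals are carried by finitely many separated patches `Φ_m(D_m)` with normals `a_m`
(`∫_S div η = Σ_m ∫_{D_m} ⟪η ∘ Φ_m, a_m⟫` for all `η ∈ C¹_c`).  If the patches of a sub-family `M' ⊆ M` lie
INSIDE the open set `U`, then

  `ofReal (Σ_{m ∈ M'} h_K(a_m)·|D_m|) ≤ anisotropicPerimeterIn K S U`      (`facetSum_le_anisotropicPerimeterIn`).

Proof = the cut-off argument of the global lower bound with the «other patches» closed set enlarged by `Uᶜ`,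
so that the cut-offs — and hence the exposing field `Σ_{m∈M'} χ_m·k_m` — have topological support inside `U`
(`exists_separated_cutoffs_tsupport`: the separated cut-offs of `AnisotropicPerimeterPatches` with the extra
export `tsupport χ_m ∩ G_m = ∅`).  Consumer: the energy localisation of the Crystal3D texture build (line
`TexShadow`, stmt-Ventures-23912, TB-0.md TB-D «L-loc»: tent facets inside a free zone are paid by the tent's
localized perimeter bound).
[cite: Maggi2012, (12.2)–(12.3) p. 122 and (20.2) p. 258, Remark 20.3; EvansGariepy2015, Thm 5.16 (Gauss–Green), polyhedral case]
-/

noncomputable section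

namespace Literature.Analysis.Convexity

open _root_.MeasureTheory Set
open scoped ENNReal NNReal RealInnerProductSpace Topology
open Literature.MathematicalPhysics.StatisticalMechanics (fieldDivergence)

variable {V : Type*} [NormedAddCommGroup V] [InnerProductSpace ℝ V]

/-- **Separated cut-offs with controlled topological support.**  Given compact cores `T_m` and closed sets
`G_m ⊇ ⋃_{m' ≠ m} T_{m'}` with `T_m ∩ G_m = ∅`, there are `C¹` compactly supported `χ_m : V → [0,1]`,
`χ_m ≡ 1` on `T_m`, `χ_m ≡ 0` on `G_m`, `Σ_m χ_m ≤ 1`, and moreover `tsupport χ_m ∩ G_m = ∅`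
(the construction of `exists_separated_cutoffs`, whose cut-offs live in a thickening of `T_m` separated from a
thickening of `G_m`).
[cite: EvansGariepy2015, Thm 5.16 (Gauss–Green), polyhedral case — plumbing] -/
theorem exists_separated_cutoffs_tsupport [FiniteDimensional ℝ V] {μ : Type*} (M : Finset μ) (T G : μ → Set V)
    (hT : ∀ m ∈ M, IsCompact (T m)) (hG : ∀ m ∈ M, IsClosed (G m))
    (hTG : ∀ m ∈ M, Disjoint (T m) (G m)) (hsub : ∀ m ∈ M, ∀ m' ∈ M, m' ≠ m → T m' ⊆ G m) :
    ∃ χ : μ → V → ℝ, (∀ m ∈ M, ContDiff ℝ 1 (χ m)) ∧ (∀ m ∈ M, HasCompactSupport (χ m)) ∧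
      (∀ m ∈ M, ∀ x, 0 ≤ χ m x ∧ χ m x ≤ 1) ∧ (∀ x, ∑ m ∈ M, χ m x ≤ 1) ∧
      (∀ m ∈ M, ∀ x ∈ T m, χ m x = 1) ∧ (∀ m ∈ M, ∀ x ∈ G m, χ m x = 0) ∧
      (∀ m ∈ M, Disjoint (tsupport (χ m)) (G m)) := by
  classical
  have hδex : ∀ m, m ∈ M → ∃ δ : ℝ, 0 < δ ∧
      Disjoint (Metric.cthickening δ (T m)) (Metric.cthickening δ (G m)) :=
    fun m hm => (hTG m hm).exists_cthickenings (hT m hm) (hG m hm)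
  choose! δ hδpos hδdisj using hδex
  have hχex : ∀ m, m ∈ M → ∃ χ : V → ℝ, ContDiff ℝ 1 χ ∧ HasCompactSupport χ ∧
      tsupport χ ⊆ Metric.thickening (δ m) (T m) ∧ (∀ x ∈ T m, χ x = 1) ∧ ∀ x, 0 ≤ χ x ∧ χ x ≤ 1 :=
    fun m hm => exists_contDiff_cutoff_Icc (hT m hm) Metric.isOpen_thickening
      (Metric.self_subset_thickening (hδpos m hm) _)
  choose! χ hχ1 hχc hχsupp hχT hχ01 using hχex
  have hsuppc : ∀ m ∈ M, tsupport (χ m) ⊆ Metric.cthickening (δ m) (T m) :=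
    fun m hm => (hχsupp m hm).trans (Metric.thickening_subset_cthickening _ _)
  have hdisjTs : ∀ m ∈ M, Disjoint (tsupport (χ m)) (G m) := fun m hm =>
    Set.disjoint_of_subset (hsuppc m hm) (Metric.self_subset_cthickening _) (hδdisj m hm)
  refine ⟨χ, hχ1, hχc, hχ01, ?_, hχT, ?_, hdisjTs⟩
  · intro x
    by_cases hex : ∃ m₀ ∈ M, χ m₀ x ≠ 0
    · obtain ⟨m₀, hm₀, hne⟩ := hex
      have hx₀ : x ∈ Metric.cthickening (δ m₀) (T m₀) := hsuppc m₀ hm₀ (subset_tsupport _ hne)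
      have hothers : ∀ m ∈ M, m ≠ m₀ → χ m x = 0 := by
        intro m hm hmm
        by_contra hne'
        have hxm : x ∈ Metric.cthickening (δ m) (T m) := hsuppc m hm (subset_tsupport _ hne')
        rcases le_total (δ m) (δ m₀) with hle | hle
        · have : x ∈ Metric.cthickening (δ m₀) (G m₀) :=
            Metric.cthickening_subset_of_subset _ (hsub m₀ hm₀ m hm hmm)
              (Metric.cthickening_mono hle _ hxm)
          exact Set.disjoint_left.1 (hδdisj m₀ hm₀) hx₀ this
        · have : x ∈ Metric.cthickening (δ m) (G m) :=
            Metric.cthickening_subset_of_subset _ (hsub m hm m₀ hm₀ (Ne.symm hmm))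
              (Metric.cthickening_mono hle _ hx₀)
          exact Set.disjoint_left.1 (hδdisj m hm) hxm this
      rw [Finset.sum_eq_single_of_mem m₀ hm₀ fun m hm hmm => hothers m hm hmm]
      exact (hχ01 m₀ hm₀ x).2
    · have h0 : ∀ m ∈ M, χ m x = 0 := fun m hm => by
        by_contra h; exact hex ⟨m, hm, h⟩
      rw [Finset.sum_eq_zero h0]; exact zero_le_one
  · intro m hm x hx
    exact image_eq_zero_of_notMem_tsupport fun h => Set.disjoint_left.1 (hdisjTs m hm) h hx

/-- **The patch theorem, localized lower bound** (see the module docstring): with the divergence identity over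
finitely many separated patches and a sub-family `M' ⊆ M` of patches contained in the open set `U`,
`ofReal (Σ_{m ∈ M'} h_K(a_m)·|D_m|) ≤ anisotropicPerimeterIn K S U` for every compact convex `K ∋ 0`.
[cite: Maggi2012, (12.2) p. 122 and (20.2) p. 258, Remark 20.3; EvansGariepy2015, Thm 5.16 (Gauss–Green), polyhedral case] -/
theorem facetSum_le_anisotropicPerimeterIn [FiniteDimensional ℝ V] [MeasurableSpace V]
    [BorelSpace V] {μ : Type*} (M : Finset μ)
    (Φ : μ → ℝ × ℝ → V) (hΦ : ∀ m ∈ M, Continuous (Φ m))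
    (D : μ → Set (ℝ × ℝ)) (hDm : ∀ m ∈ M, MeasurableSet (D m)) (hDf : ∀ m ∈ M, volume (D m) ≠ ⊤)
    (a : μ → V)
    (hsep : ∀ m ∈ M, ∀ m' ∈ M, m ≠ m' → Disjoint (Φ m '' D m) (closure (Φ m' '' D m')))
    {S : Set V}
    (hdiv : ∀ η : V → V, ContDiff ℝ 1 η → HasCompactSupport η →
      ∫ x in S, fieldDivergence η x = ∑ m ∈ M, ∫ y in D m, ⟪η (Φ m y), a m⟫)
    {U : Set V} (hU : IsOpen U) (M' : Finset μ) (hM' : M' ⊆ M) (hin : ∀ m ∈ M', Φ m '' D m ⊆ U)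
    {K : Set V} (hKc : IsCompact K) (hK : Convex ℝ K) (hK0 : (0 : V) ∈ K) :
    ENNReal.ofReal (∑ m ∈ M', sSup ((fun y => ⟪y, a m⟫) '' K) * (volume (D m)).toReal) ≤
      anisotropicPerimeterIn K S U := by
  classical
  set h : μ → ℝ := fun m => sSup ((fun y => ⟪y, a m⟫) '' K) with hh
  have hpos : ∀ m, 0 ≤ h m := fun m => sSup_inner_nonneg hKc hK0 (a m)
  obtain ⟨kv, hkvK, hkv⟩ : ∃ kv : μ → V, (∀ m, kv m ∈ K) ∧ ∀ m, ⟪kv m, a m⟫ = h m := by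
    have := fun m => exists_mem_inner_eq_sSup hKc ⟨0, hK0⟩ (a m)
    choose kv hkvK hkv using this
    exact ⟨kv, hkvK, hkv⟩
  set Hs : ℝ := ∑ m ∈ M', h m with hHs
  have hHs0 : 0 ≤ Hs := Finset.sum_nonneg fun m _ => hpos m
  refine ENNReal.le_of_forall_pos_le_add fun ε hε _ => ?_
  have hε' : 0 < (ε : ℝ) / (Hs + 1) := div_pos (by exact_mod_cast hε) (by linarith)
  -- compact cores of almost full measure, for the patches of `M'`
  have hcore : ∀ m, m ∈ M' → ∃ C : Set (ℝ × ℝ), C ⊆ D m ∧ IsCompact C ∧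
      volume (D m \ C) < ENNReal.ofReal ((ε : ℝ) / (Hs + 1)) :=
    fun m hm => (hDm m (hM' hm)).exists_isCompact_sdiff_lt (hDf m (hM' hm)) (ENNReal.ofReal_pos.2 hε').ne'
  choose! C hCD hCc hCvol using hcore
  -- cores in `V`; the closed «forbidden» sets: all OTHER patches of `M` and the complement of `U`
  set T : μ → Set V := fun m => Φ m '' C m with hT
  set G : μ → Set V := fun m => (⋃ m' ∈ M.erase m, closure (Φ m' '' D m')) ∪ Uᶜ with hG
  have hTc : ∀ m ∈ M', IsCompact (T m) := fun m hm => (hCc m hm).image (hΦ m (hM' hm))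
  have hGc : ∀ m ∈ M', IsClosed (G m) := fun m _ =>
    (isClosed_biUnion_finset fun m' _ => isClosed_closure).union hU.isClosed_compl
  have hTD : ∀ m ∈ M', T m ⊆ Φ m '' D m := fun m hm => Set.image_mono (hCD m hm)
  have hDG : ∀ m ∈ M', ∀ m' ∈ M, m' ≠ m → Φ m' '' D m' ⊆ G m := by
    intro m _ m' hm' hne x hx
    exact Or.inl (Set.mem_biUnion (Finset.mem_erase.2 ⟨hne, hm'⟩) (subset_closure hx))
  have hTG : ∀ m ∈ M', Disjoint (T m) (G m) := by
    intro m hm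
    rw [hG, Set.disjoint_union_right, Set.disjoint_iUnion₂_right]
    refine ⟨fun m' hm' => ?_, ?_⟩
    · obtain ⟨hne, hm'M⟩ := Finset.mem_erase.1 hm'
      exact Disjoint.mono_left (hTD m hm) (hsep m (hM' hm) m' hm'M (Ne.symm hne))
    · exact Set.disjoint_compl_right_iff_subset.2 ((hTD m hm).trans (hin m hm))
  have hsubTG : ∀ m ∈ M', ∀ m' ∈ M', m' ≠ m → T m' ⊆ G m :=
    fun m hm m' hm' hne => (hTD m' hm').trans (hDG m hm m' (hM' hm') hne)
  obtain ⟨χ, hχ1, hχc, hχ01, hχs, hχT, hχG, hχsupp⟩ :=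
    exists_separated_cutoffs_tsupport M' T G hTc hGc hTG hsubTG
  -- the field `φ = Σ_{m ∈ M'} χ_m • k_m`
  set φ : V → V := fun x => ∑ m ∈ M', χ m x • kv m with hφ
  have hφ1 : ContDiff ℝ 1 φ := ContDiff.sum fun m hm => (hχ1 m hm).smul contDiff_const
  have hφc : HasCompactSupport φ := by
    have key : ∀ s : Finset μ, s ⊆ M' → HasCompactSupport (fun x : V => ∑ m ∈ s, χ m x • kv m) := by
      intro s
      induction s using Finset.induction_on with
      | empty =>
        intro _
        rw [show (fun x : V => ∑ m ∈ (∅ : Finset μ), χ m x • kv m) = 0 from funext fun x => by simp]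
        exact HasCompactSupport.zero
      | insert i s hi ih =>
        intro hsub
        simp_rw [Finset.sum_insert hi]
        refine HasCompactSupport.add ?_ (ih fun j hj => hsub (Finset.mem_insert_of_mem hj))
        exact (hχc i (hsub (Finset.mem_insert_self i s))).smul_right (f' := fun _ => kv i)
    exact key M' le_rfl
  have hφK : ∀ x, φ x ∈ K := fun x =>
    subconvex_sum_mem hK hK0 (fun m => χ m x) kv (fun m hm => (hχ01 m hm x).1) (hχs x)
      fun m _ => hkvK m
  -- the field is supported inside `U`
  have hφU : tsupport φ ⊆ U := by
    have hF : IsClosed (⋃ m ∈ M', tsupport (χ m)) := isClosed_biUnion_finset fun m _ => isClosed_tsupport _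
    have hFU : (⋃ m ∈ M', tsupport (χ m)) ⊆ U := by
      intro x hx
      obtain ⟨m, hm, hxm⟩ := Set.mem_iUnion₂.1 hx
      by_contra hxU
      exact Set.disjoint_left.1 (hχsupp m hm) hxm (Or.inr hxU)
    refine (closure_minimal ?_ hF).trans hFU
    intro x hx
    rw [Function.mem_support] at hx
    by_contra hnot
    apply hx
    refine Finset.sum_eq_zero fun m hm => ?_
    have : χ m x = 0 := by
      by_contra hne
      exact hnot (Set.mem_iUnion₂.2 ⟨m, hm, subset_tsupport _ hne⟩)
    rw [this, zero_smul]
  -- on a patch of `M'` the field is `χ_m • k_m`; on the other patches of `M` it vanishes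
  have hφon : ∀ m ∈ M', ∀ y ∈ D m, φ (Φ m y) = χ m (Φ m y) • kv m := by
    intro m hm y hy
    rw [hφ]
    simp only
    rw [Finset.sum_eq_single_of_mem m hm]
    intro m' hm' hne
    have hx : Φ m y ∈ G m' := hDG m' hm' m (hM' hm) (Ne.symm hne) (Set.mem_image_of_mem _ hy)
    rw [hχG m' hm' _ hx, zero_smul]
  have hφoff : ∀ m ∈ M, m ∉ M' → ∀ y ∈ D m, φ (Φ m y) = 0 := by
    intro m hm hmM' y hy
    rw [hφ]
    refine Finset.sum_eq_zero fun m' hm' => ?_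
    have hne : m ≠ m' := fun h => hmM' (h ▸ hm')
    have hx : Φ m y ∈ G m' := hDG m' hm' m hm hne (Set.mem_image_of_mem _ hy)
    rw [hχG m' hm' _ hx, zero_smul]
  -- evaluate the divergence integral of `φ` patch by patch
  have hI : ∀ m ∈ M', ∫ y in D m, ⟪φ (Φ m y), a m⟫ = h m * ∫ y in D m, χ m (Φ m y) := by
    intro m hm
    rw [← integral_const_mul]
    refine setIntegral_congr_fun (hDm m (hM' hm)) fun y hy => ?_
    rw [hφon m hm y hy, inner_smul_left, hkv m]
    simp [mul_comm]
  have hI0 : ∀ m ∈ M, m ∉ M' → ∫ y in D m, ⟪φ (Φ m y), a m⟫ = 0 := by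
    intro m hm hmM'
    have h0 : ∫ y in D m, ⟪φ (Φ m y), a m⟫ = ∫ y in D m, (0 : ℝ) :=
      setIntegral_congr_fun (hDm m hm) fun y hy => by rw [hφoff m hm hmM' y hy, inner_zero_left]
    rw [h0, integral_zero]
  have hIge : ∀ m ∈ M', (volume (D m)).toReal - (ε : ℝ) / (Hs + 1) ≤ ∫ y in D m, χ m (Φ m y) := by
    intro m hm
    have hCfin : volume (C m) ≠ ⊤ := (lt_of_le_of_lt (measure_mono (hCD m hm))
      (lt_top_iff_ne_top.2 (hDf m (hM' hm)))).ne
    have hsplit : volume (D m) ≤ volume (C m) + volume (D m \ C m) := by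
      calc volume (D m) ≤ volume (C m ∪ (D m \ C m)) := measure_mono (fun y hy => by
              by_cases h : y ∈ C m; exact Or.inl h; exact Or.inr ⟨hy, h⟩)
        _ ≤ volume (C m) + volume (D m \ C m) := measure_union_le _ _
    have h1 : volume (D m) ≤ volume (C m) + ENNReal.ofReal ((ε : ℝ) / (Hs + 1)) :=
      hsplit.trans (add_le_add le_rfl (hCvol m hm).le)
    have h2 := ENNReal.toReal_mono (ENNReal.add_ne_top.2 ⟨hCfin, ENNReal.ofReal_ne_top⟩) h1
    rw [ENNReal.toReal_add hCfin ENNReal.ofReal_ne_top, ENNReal.toReal_ofReal hε'.le] at h2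
    have hCmeas : MeasurableSet (C m) := (hCc m hm).isClosed.measurableSet
    have hint : IntegrableOn (fun y => χ m (Φ m y)) (D m) volume :=
      integrableOn_of_continuous_of_bound ((hχ1 m hm).continuous.comp' (hΦ m (hM' hm))) (C := 1)
        (fun y => by
          rw [Real.norm_eq_abs, abs_le]
          exact ⟨by linarith [(hχ01 m hm (Φ m y)).1], (hχ01 m hm (Φ m y)).2⟩) (hDf m (hM' hm))
    have h3 : ∫ y in D m, (C m).indicator (fun _ => (1 : ℝ)) y ≤ ∫ y in D m, χ m (Φ m y) := by
      have hindint : IntegrableOn (fun y => (C m).indicator (fun _ => (1 : ℝ)) y) (D m) volume :=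
        ((integrable_indicator_iff hCmeas).2 (integrableOn_const hCfin)).integrableOn
      refine setIntegral_mono hindint hint fun y => ?_
      by_cases hy : y ∈ C m
      · rw [Set.indicator_of_mem hy, hχT m hm _ (Set.mem_image_of_mem _ hy)]
      · rw [Set.indicator_of_notMem hy]; exact (hχ01 m hm _).1
    have h4 : ∫ y in D m, (C m).indicator (fun _ => (1 : ℝ)) y = (volume (C m)).toReal := by
      rw [setIntegral_indicator hCmeas, Set.inter_eq_self_of_subset_right (hCD m hm),
        setIntegral_const, smul_eq_mul, mul_one, measureReal_def]
    linarith
  -- sum up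
  have hsum : ∑ m ∈ M', h m * (volume (D m)).toReal ≤ (∫ x in S, fieldDivergence φ x) + ε := by
    rw [hdiv φ hφ1 hφc]
    -- the patches outside `M'` contribute nothing
    have hsplit : ∑ m ∈ M, ∫ y in D m, ⟪φ (Φ m y), a m⟫ = ∑ m ∈ M', ∫ y in D m, ⟪φ (Φ m y), a m⟫ := by
      rw [← Finset.sum_subset hM' (fun m hm hmM' => hI0 m hm hmM')]
    rw [hsplit]
    have h1 : ∀ m ∈ M', h m * (volume (D m)).toReal ≤
        (∫ y in D m, ⟪φ (Φ m y), a m⟫) + h m * ((ε : ℝ) / (Hs + 1)) := by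
      intro m hm
      rw [hI m hm]
      nlinarith [hpos m, hIge m hm]
    have h2 := Finset.sum_le_sum h1
    rw [Finset.sum_add_distrib, ← Finset.sum_mul] at h2
    have h3 : Hs * ((ε : ℝ) / (Hs + 1)) ≤ ε := by
      rw [mul_div_assoc', div_le_iff₀ (by linarith)]
      nlinarith [hHs0, (show (0:ℝ) ≤ ε from by exact_mod_cast hε.le)]
    linarith
  calc ENNReal.ofReal (∑ m ∈ M', h m * (volume (D m)).toReal)
      ≤ ENNReal.ofReal ((∫ x in S, fieldDivergence φ x) + ε) := ENNReal.ofReal_le_ofReal hsum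
    _ ≤ ENNReal.ofReal (∫ x in S, fieldDivergence φ x) + ENNReal.ofReal ε := ENNReal.ofReal_add_le
    _ ≤ anisotropicPerimeterIn K S U + ε := by
        rw [ENNReal.ofReal_coe_nnreal]
        exact add_le_add (le_anisotropicPerimeterIn hφ1 hφc hφK hφU) le_rfl

end Literature.Analysis.Convexity

end
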